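import Summits.SmoothPoincare4.SmoothPoincare4.Theorems.SullivanDualTargetCroftonPencilDefs
import Summits.SmoothPoincare4.SmoothPoincare4.Theorems.SullivanDualWitnessChargeFlatChart
import Summits.SmoothPoincare4.SmoothPoincare4.Theorems.SullivanDualTargetStubCollar
import Mathlib.Analysis.SpecialFunctions.JapaneseBracket

/-!
# Helper `helper_lineEnergy_flat_lt_top` of the line `crofton-pencil-laminar-charge` for crux `Target`
(item stmt-SmoothPoincare4-7823, route route-SmoothPoincare4-SullivanDual)

The FLAT LINES have finite energy: if a curve `u : ℂ → Σ ∖ p` lies in the punctured `ε'`-chart-ball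
(closed `ε'`-ball inside the chart target) and its complex flat coordinates in chart `σ` are EXACTLY
the affine line `Yc σ p (u ξ) = (ξ, a ξ + b)`, then for every smooth `ι : Σ → ℝᴺ` the energy
`lineEnergy ι u = ∫⁻ ‖d(ι ∘ u)‖²` is finite. This is the base case of the far-energy estimate of
`stub_linesOrCurve` and the non-vacuity of `BoundedLines`.

Proof. On the ball, `x = e.symm (e p + inv (realify (Ycoord p x)))` (`e = extChartAt (𝓡 4) p`,
`inv = inversion`), so `ι ∘ u = g ∘ F` with `g = ι ∘ e.symm` (smooth on the open chart target,
hence with derivative bounded by some `M` on the compact closed `ε'`-ball) and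
`F ζ = e p + inv (realify (L ζ + c))` for the affine map `ζ ↦ L ζ + c` (`= (ζ, aζ+b)` or
`(aζ+b, ζ)`). The chain rule and `‖D inv(y)‖ ≤ ‖y‖⁻²` give
`‖d(ι ∘ u)(ζ)‖ ≤ C ‖realify (L ζ + c)‖⁻²`, and `‖realify (L ζ + c)‖ ≥ max (‖ζ‖, ε'⁻¹)`, whence
`‖d(ι ∘ u)(ζ)‖² ≤ C' (1 + ‖ζ‖)⁻⁴`, which is integrable on `ℂ` (`finite_integral_one_add_norm`,
`finrank ℝ ℂ = 2 < 4`).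
-/

noncomputable section

-- the prescribed namespace `Summit.<P>.<Sub>.…` duplicates `SmoothPoincare4` (P = Sub)
set_option linter.dupNamespace false

open scoped Manifold ContDiff Topology ENNReal NNReal
open Set Filter MeasureTheory Literature.Geometry.Kaehler Literature.Geometry.Symplectic
  Literature.Topology.FourManifolds
open Summit.SmoothPoincare4.SmoothPoincare4.Theorems.WitnessCharge.PencilIncompleteness

namespace Summit.SmoothPoincare4.SmoothPoincare4.Theorems.Target.CroftonPencil

variable {S : HomotopySphere 4}

/-! ### Elementary inequalities -/

/-- `‖q.1‖ ≤ ‖realify q‖`. -/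
theorem norm_fst_le_norm_realify (q : ℂ × ℂ) : ‖q.1‖ ≤ ‖realify q‖ := by
  have h := norm_realify_sq q
  nlinarith [norm_nonneg q.1, norm_nonneg (realify q), norm_nonneg q.2, sq_nonneg ‖q.2‖]

/-- `‖q.2‖ ≤ ‖realify q‖`. -/
theorem norm_snd_le_norm_realify (q : ℂ × ℂ) : ‖q.2‖ ≤ ‖realify q‖ := by
  have h := norm_realify_sq q
  nlinarith [norm_nonneg q.1, norm_nonneg (realify q), norm_nonneg q.2, sq_nonneg ‖q.1‖]

/-- The operator norm of the derivative of the inversion: `‖D inv(y)‖ ≤ ‖y‖⁻²` for `y ≠ 0`. -/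
theorem norm_fderiv_inversion_le {y : EuclideanSpace ℝ (Fin 4)} (hy : y ≠ 0) :
    ‖fderiv ℝ inversion y‖ ≤ (‖y‖ ^ 2)⁻¹ :=
  ContinuousLinearMap.opNorm_le_bound _ (by positivity) fun w => by
    rw [SullivanDual.norm_fderiv_inversion_apply hy, div_eq_inv_mul]

/-- The real inequality behind the decay: if `0 < m ≤ 1`, `m ≤ r`, `0 ≤ t ≤ r` and
`0 ≤ D ≤ C r⁻²`, then `D² ≤ (16 C² / m⁴) (1 + t)⁻⁴`. -/
theorem sq_le_decay {m r t D C : ℝ} (hm : 0 < m) (hm1 : m ≤ 1) (hmr : m ≤ r) (htr : t ≤ r)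
    (ht : 0 ≤ t) (hD0 : 0 ≤ D) (hD : D ≤ C * (r ^ 2)⁻¹) :
    D ^ 2 ≤ (16 * C ^ 2 / m ^ 4) * (1 + t) ^ (-(4 : ℝ)) := by
  have hr : 0 < r := hm.trans_le hmr
  have h1t : 0 < 1 + t := by positivity
  rw [Real.rpow_neg h1t.le, Real.rpow_ofNat]
  have hmt : m * t ≤ t := by nlinarith
  have hkey : m * (1 + t) ≤ 2 * r := by nlinarith
  have hpow : (m * (1 + t)) ^ 4 ≤ (2 * r) ^ 4 := pow_le_pow_left₀ (by positivity) hkey 4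
  have hD2 : D ^ 2 ≤ (C * (r ^ 2)⁻¹) ^ 2 := pow_le_pow_left₀ hD0 hD 2
  have hinv : ((2 * r) ^ 4)⁻¹ ≤ ((m * (1 + t)) ^ 4)⁻¹ := inv_anti₀ (by positivity) hpow
  calc D ^ 2 ≤ (C * (r ^ 2)⁻¹) ^ 2 := hD2
    _ = 16 * C ^ 2 * ((2 * r) ^ 4)⁻¹ := by
        field_simp
        ring
    _ ≤ 16 * C ^ 2 * ((m * (1 + t)) ^ 4)⁻¹ := by gcongr
    _ = 16 * C ^ 2 / m ^ 4 * ((1 + t) ^ 4)⁻¹ := by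
        field_simp

/-! ### The derivative bound for a curve with affine flat coordinates -/

section Affine

variable {p : S.carrier} {ε' : ℝ} {N : ℕ} {ι : S.carrier → EuclideanSpace ℝ (Fin N)}
  {u : ℂ → punctured p} {L : ℂ →L[ℝ] ℂ × ℂ} {c : ℂ × ℂ}
  (hε' : 0 < ε')
  (hball : Metric.closedBall (extChartAt (𝓡 4) p p) ε' ⊆ (extChartAt (𝓡 4) p).target)
  (hι : ContMDiff (𝓡 4) 𝓘(ℝ, EuclideanSpace ℝ (Fin N)) ∞ ι)
  (hmem : ∀ ζ : ℂ, InPuncturedChartBall p ε' (u ζ))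
  (hq : ∀ ζ : ℂ, Ycoord p (u ζ) = L ζ + c)
include hε' hball hι hmem hq

/-- Pointwise derivative bound: if `u` lies in the punctured `ε'`-chart-ball with affine flat
coordinates `Ycoord p (u ζ) = L ζ + c`, then `‖d(ι ∘ u)(ζ)‖ ≤ C ‖realify (L ζ + c)‖⁻²` for a
constant `C` (chain rule through `g = ι ∘ e.symm`, whose derivative is bounded on the compact
closed `ε'`-ball, and `‖D inv(y)‖ ≤ ‖y‖⁻²`). -/
theorem norm_fderiv_comp_le_of_affine :
    ∃ C : ℝ, ∀ ζ : ℂ,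
      ‖fderiv ℝ (fun ζ : ℂ => ι (u ζ).1) ζ‖ ≤ C * (‖realify (L ζ + c)‖ ^ 2)⁻¹ := by
  -- `g = ι ∘ e.symm` is smooth on the open chart target
  have hg : ContDiffOn ℝ ∞ (ι ∘ (extChartAt (𝓡 4) p).symm) (extChartAt (𝓡 4) p).target :=
    contMDiffOn_iff_contDiffOn.1
      (hι.comp_contMDiffOn (contMDiffOn_extChartAt_symm (I := 𝓡 4) (n := ∞) p))
  have hcont : ContinuousOn (fderiv ℝ (ι ∘ (extChartAt (𝓡 4) p).symm))
      (extChartAt (𝓡 4) p).target :=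
    hg.continuousOn_fderiv_of_isOpen (isOpen_extChartAt_target (I := 𝓡 4) p) (by simp)
  -- hence its derivative is bounded on the compact closed `ε'`-ball
  obtain ⟨M, hM⟩ := (isCompact_closedBall (extChartAt (𝓡 4) p p) ε').exists_bound_of_continuousOn
    (hcont.mono hball)
  have hM0 : 0 ≤ M := (norm_nonneg _).trans (hM _ (Metric.mem_closedBall_self hε'.le))
  refine ⟨M * ‖realifyL.comp L‖, fun ζ => ?_⟩
  have hstd : ε'⁻¹ < ‖realify (L ζ + c)‖ := by
    rw [← hq ζ]
    exact Ycoord_mem_stdEnd hε' (hmem ζ)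
  have hy0 : realify (L ζ + c) ≠ 0 := realify_ne_zero_of_lt hε' hstd
  have hballmem : extChartAt (𝓡 4) p p + inversion (realify (L ζ + c)) ∈
      Metric.closedBall (extChartAt (𝓡 4) p p) ε' := by
    rw [Metric.mem_closedBall, dist_eq_norm, add_sub_cancel_left]
    exact (norm_inversion_realify_lt_of_lt hε' hstd).le
  have htgt : extChartAt (𝓡 4) p p + inversion (realify (L ζ + c)) ∈ (extChartAt (𝓡 4) p).target :=
    hball hballmem
  -- the curve factors through the flat chart: `ι ∘ u = g ∘ F`
  have hfun : (fun ζ : ℂ => ι (u ζ).1) = fun ζ : ℂ =>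
      (ι ∘ (extChartAt (𝓡 4) p).symm)
        (extChartAt (𝓡 4) p p + inversion (realify (L ζ + c))) := by
    funext ζ'
    rw [Function.comp_apply, ← hq ζ', realify_Ycoord, inversion_inversion, add_sub_cancel,
      (extChartAt (𝓡 4) p).left_inv (by rw [extChartAt_source]; exact (hmem ζ').1)]
  -- derivative of the inner map `F ζ = e p + inv (realify (L ζ + c))`
  have hF : HasFDerivAt (fun ζ : ℂ => extChartAt (𝓡 4) p p + inversion (realify (L ζ + c)))
      ((fderiv ℝ inversion (realify (L ζ + c))).comp (realifyL.comp L)) ζ := by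
    have h1 : HasFDerivAt (fun ζ : ℂ => L ζ + c) L ζ := L.hasFDerivAt.add_const c
    have h2 : HasFDerivAt (fun q : ℂ × ℂ => realify q) realifyL (L ζ + c) := realifyL.hasFDerivAt
    have h3 : HasFDerivAt inversion (fderiv ℝ inversion (realify (L ζ + c))) (realify (L ζ + c)) :=
      (differentiableAt_inversion hy0).hasFDerivAt
    exact (h3.comp ζ (h2.comp ζ h1)).const_add (extChartAt (𝓡 4) p p)
  -- derivative of the outer map
  have hgd : DifferentiableAt ℝ (ι ∘ (extChartAt (𝓡 4) p).symm)
      (extChartAt (𝓡 4) p p + inversion (realify (L ζ + c))) :=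
    (hg.differentiableOn (by simp)).differentiableAt
      ((isOpen_extChartAt_target (I := 𝓡 4) p).mem_nhds htgt)
  have hD : fderiv ℝ (fun ζ : ℂ => ι (u ζ).1) ζ =
      (fderiv ℝ (ι ∘ (extChartAt (𝓡 4) p).symm)
        (extChartAt (𝓡 4) p p + inversion (realify (L ζ + c)))).comp
        ((fderiv ℝ inversion (realify (L ζ + c))).comp (realifyL.comp L)) := by
    rw [hfun]
    exact (hgd.hasFDerivAt.comp ζ hF).fderiv
  rw [hD]
  calc ‖(fderiv ℝ (ι ∘ (extChartAt (𝓡 4) p).symm)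
          (extChartAt (𝓡 4) p p + inversion (realify (L ζ + c)))).comp
          ((fderiv ℝ inversion (realify (L ζ + c))).comp (realifyL.comp L))‖
        ≤ ‖fderiv ℝ (ι ∘ (extChartAt (𝓡 4) p).symm)
            (extChartAt (𝓡 4) p p + inversion (realify (L ζ + c)))‖ *
          ‖(fderiv ℝ inversion (realify (L ζ + c))).comp (realifyL.comp L)‖ :=
      ContinuousLinearMap.opNorm_comp_le _ _
    _ ≤ M * ((‖realify (L ζ + c)‖ ^ 2)⁻¹ * ‖realifyL.comp L‖) := by
      gcongr
      · exact hM _ hballmem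
      · exact (ContinuousLinearMap.opNorm_comp_le _ _).trans
          (mul_le_mul_of_nonneg_right (norm_fderiv_inversion_le hy0) (norm_nonneg _))
    _ = M * ‖realifyL.comp L‖ * (‖realify (L ζ + c)‖ ^ 2)⁻¹ := by ring

/-- Finite energy for a curve in the punctured `ε'`-chart-ball with affine flat coordinates
`Ycoord p (u ζ) = L ζ + c` dominating the parameter (`‖ζ‖ ≤ ‖realify (L ζ + c)‖`). -/
theorem lineEnergy_lt_top_of_affine (hζ : ∀ ζ : ℂ, ‖ζ‖ ≤ ‖realify (L ζ + c)‖) :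
    lineEnergy ι u < ⊤ := by
  obtain ⟨C, hC⟩ := norm_fderiv_comp_le_of_affine hε' hball hι hmem hq
  have hm : 0 < min 1 ε'⁻¹ := lt_min one_pos (inv_pos.2 hε')
  have hK0 : 0 ≤ 16 * C ^ 2 / (min 1 ε'⁻¹) ^ 4 := by positivity
  have hpt : ∀ ζ : ℂ, ‖fderiv ℝ (fun ζ : ℂ => ι (u ζ).1) ζ‖ ^ 2 ≤
      16 * C ^ 2 / (min 1 ε'⁻¹) ^ 4 * (1 + ‖ζ‖) ^ (-(4 : ℝ)) := fun ζ => by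
    have hstd : ε'⁻¹ < ‖realify (L ζ + c)‖ := by
      rw [← hq ζ]
      exact Ycoord_mem_stdEnd hε' (hmem ζ)
    exact sq_le_decay hm (min_le_left _ _) ((min_le_right _ _).trans hstd.le) (hζ ζ)
      (norm_nonneg ζ) (norm_nonneg _) (hC ζ)
  unfold lineEnergy
  calc ∫⁻ ξ : ℂ, ENNReal.ofReal (‖fderiv ℝ (fun ζ : ℂ => ι (u ζ).1) ξ‖ ^ 2)
      ≤ ∫⁻ ξ : ℂ, ENNReal.ofReal (16 * C ^ 2 / (min 1 ε'⁻¹) ^ 4) *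
          ENNReal.ofReal ((1 + ‖ξ‖) ^ (-(4 : ℝ))) :=
        lintegral_mono fun ξ => by
          rw [← ENNReal.ofReal_mul hK0]
          exact ENNReal.ofReal_le_ofReal (hpt ξ)
    _ = ENNReal.ofReal (16 * C ^ 2 / (min 1 ε'⁻¹) ^ 4) *
          ∫⁻ ξ : ℂ, ENNReal.ofReal ((1 + ‖ξ‖) ^ (-(4 : ℝ))) :=
        lintegral_const_mul' _ _ ENNReal.ofReal_ne_top
    _ < ⊤ := ENNReal.mul_lt_top ENNReal.ofReal_lt_top
        (finite_integral_one_add_norm (by rw [Complex.finrank_real_complex]; norm_num))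

end Affine

/-! ### The registered helper -/

/-- **Registered helper `helper_lineEnergy_flat_lt_top`** (line `crofton-pencil-laminar-charge`,
crux `Target`): a curve `u : ℂ → Σ ∖ p` in the punctured `ε'`-chart-ball (closed `ε'`-ball inside
the chart target) whose complex flat coordinates in chart `σ` are exactly the affine line
`Yc σ p (u ξ) = (ξ, a ξ + b)` has finite energy `lineEnergy ι u < ⊤` for every smooth
`ι : Σ → ℝᴺ` — the base case of the far-energy estimate and the non-vacuity of `BoundedLines`. -/
theorem helper_lineEnergy_flat_lt_top :
    ∀ (S : HomotopySphere 4) (p : S.carrier) (ε' : ℝ) (N : ℕ)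
      (ι : S.carrier → EuclideanSpace ℝ (Fin N)) (u : ℂ → punctured p) (σ : Bool) (a b : ℂ),
      0 < ε' →
      Metric.closedBall (extChartAt (𝓡 4) p p) ε' ⊆ (extChartAt (𝓡 4) p).target →
      ContMDiff (𝓡 4) 𝓘(ℝ, EuclideanSpace ℝ (Fin N)) ∞ ι →
      (∀ ξ : ℂ, InPuncturedChartBall p ε' (u ξ) ∧ Yc σ p (u ξ) = (ξ, a * ξ + b)) →
      lineEnergy ι u < ⊤ := by
  intro S p ε' N ι u σ a b hε' hball hι hu
  cases σ with
  | false =>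
    -- chart `false`: `Ycoord p (u ζ) = (ζ, a ζ + b)`
    refine lineEnergy_lt_top_of_affine
      (L := (ContinuousLinearMap.id ℝ ℂ).prod (a • ContinuousLinearMap.id ℝ ℂ)) (c := ((0 : ℂ), b))
      hε' hball hι (fun ζ => (hu ζ).1) (fun ζ => ?_) (fun ζ => ?_)
    · have h := (hu ζ).2
      simp only [Yc, Bool.false_eq_true, ↓reduceIte] at h
      rw [h]
      simp
    · refine le_of_eq_of_le ?_ (norm_fst_le_norm_realify _)
      simp
  | true =>
    -- chart `true`: `Ycoord p (u ζ) = (a ζ + b, ζ)`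
    refine lineEnergy_lt_top_of_affine
      (L := (a • ContinuousLinearMap.id ℝ ℂ).prod (ContinuousLinearMap.id ℝ ℂ)) (c := (b, (0 : ℂ)))
      hε' hball hι (fun ζ => (hu ζ).1) (fun ζ => ?_) (fun ζ => ?_)
    · have h := (hu ζ).2
      simp only [Yc, ↓reduceIte, Prod.mk.injEq] at h
      refine Prod.ext ?_ ?_
      · rw [h.2]; simp
      · rw [h.1]; simp
    · refine le_of_eq_of_le ?_ (norm_snd_le_norm_realify _)
      simp

end Summit.SmoothPoincare4.SmoothPoincare4.Theorems.Target.CroftonPencil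

end
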